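import Summits.Parity.GeneralizedHardyLittlewood.Theorems.PolymathEpsThreeCeilingGridBoundHighRankActivityFibre

/-!
# Route `PolymathEpsThreeCeiling`, crux `GridBoundHigh` (stmt-Parity-19069): tools for the remaining fibre-budget
# inequality of the rank/activity certificates

After `…RankActivity.lean`, `…RankActivityFibre.lean` (and the five-constant parameter file), the ONE remaining obligation
of `stub_cwCertsHigh` along the prover hand's line is, per `j`, the hypothesis `H` of
`RankActivity.cwCert_of_rankActivity`: `∫⁻ u in Ioc 0 (1+ε-s₀-s₁), ofReal (fibreWeight … s₀ s₁ u)⁻¹ ≤ 1` for all outer pairs.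
Along every fibre the profile `fibreWeight` of the five-constant certificates is AFFINE in `u` on at most three
sub-intervals and CONSTANT on at most three more (item evidence `CENSUS-19069-orderone.md` §F6).  This file supplies the
three generic tools that evaluation needs, once and for all:
* `RankActivity.fibreWeight_comm` — the profile is symmetric in the outer pair, so `s₁ ≤ s₀` may be assumed;
* `RankActivity.lintegral_Ioc_inv_affine` — `∫⁻_{(a,b]} (A + B u)⁻¹ = log((A+Bb)/(A+Ba))/B` (as `ofReal`) for `B > 0`,
  `A + B a > 0`, `a ≤ b`;
* `RankActivity.lintegral_Ioc_inv_const` — `∫⁻_{(a,b]} C⁻¹ = (b-a)/C` (as `ofReal`) for `a ≤ b`;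
* `RankActivity.log_div_le` — the rational majorant `log (a/b) ≤ (a²-b²)/(2ab)` (`0 < b ≤ a`) which, applied per
  sub-panel, turns each `R1 j` into a two-variable rational inequality (appended).
Support lemmas for stmt-Parity-19069 only; no summit claim.  Standard axioms.
-/

noncomputable section

open Finset MeasureTheory Set Filter

namespace Summit.Parity.GeneralizedHardyLittlewood.Theses.PolymathEpsThreeCeiling

namespace RankActivity

/-- The fibre profile is symmetric in the outer pair `(s₀, s₁)`. -/
theorem fibreWeight_comm (ε Λ : ℝ) (c αS d₁ d₀ β : ℝ → ℝ) (s₀ s₁ u : ℝ) :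
    fibreWeight ε Λ c αS d₁ d₀ β s₀ s₁ u = fibreWeight ε Λ c αS d₁ d₀ β s₁ s₀ u := by
  unfold fibreWeight
  have hσ : u + s₁ + s₀ = u + s₀ + s₁ := by ring
  rw [hσ]
  by_cases h0 : 0 < s₀ ∧ u + s₁ ≤ 1 - ε <;> by_cases h1 : 0 < s₁ ∧ u + s₀ ≤ 1 - ε <;>
    simp [h0, h1, or_comm, and_comm]

/-- `∫⁻_{(a,b]} du/(A + B u) = log((A + B b)/(A + B a))/B` for an increasing positive affine function. -/
theorem lintegral_Ioc_inv_affine {A B a b : ℝ} (hab : a ≤ b) (hB : 0 < B) (ha : 0 < A + B * a) :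
    ∫⁻ u in Ioc a b, ENNReal.ofReal (A + B * u)⁻¹ =
      ENNReal.ofReal (Real.log ((A + B * b) / (A + B * a)) / B) := by
  have hb : 0 < A + B * b := by nlinarith
  have hpos : ∀ u ∈ Icc a b, 0 < A + B * u := fun u hu => by nlinarith [hu.1]
  -- continuity on `[a, b]` gives integrability of the inverse
  have hcont : ContinuousOn (fun u : ℝ => (A + B * u)⁻¹) (Icc a b) := by
    refine ContinuousOn.inv₀ (by fun_prop) fun u hu => (hpos u hu).ne'
  have hint : IntegrableOn (fun u : ℝ => (A + B * u)⁻¹) (Ioc a b) :=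
    (hcont.integrableOn_Icc).mono_set Ioc_subset_Icc_self
  have hnn : 0 ≤ᵐ[volume.restrict (Ioc a b)] fun u : ℝ => (A + B * u)⁻¹ := by
    rw [EventuallyLE, ae_restrict_iff' measurableSet_Ioc]
    exact Filter.Eventually.of_forall fun u hu =>
      (inv_pos.2 (hpos u (Ioc_subset_Icc_self hu))).le
  rw [← ofReal_integral_eq_lintegral_ofReal hint hnn, ← intervalIntegral.integral_of_le hab]
  congr 1
  -- evaluate the interval integral by the substitution `x = B u + A`
  have h1 : (fun u : ℝ => (A + B * u)⁻¹) = fun u => (fun x : ℝ => x⁻¹) (B * u + A) := by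
    ext u; rw [add_comm]
  rw [h1, intervalIntegral.integral_comp_mul_add (fun x : ℝ => x⁻¹) hB.ne' A, smul_eq_mul,
    integral_inv_of_pos (by linarith) (by linarith)]
  rw [show B * b + A = A + B * b by ring, show B * a + A = A + B * a by ring]
  field_simp

/-- `∫⁻_{(a,b]} du/C = (b - a)/C` (as `ofReal`; for `C ≤ 0` both sides vanish). -/
theorem lintegral_Ioc_inv_const {C a b : ℝ} (hab : a ≤ b) :
    ∫⁻ _u in Ioc a b, ENNReal.ofReal C⁻¹ = ENNReal.ofReal ((b - a) / C) := by
  rw [setLIntegral_const, Real.volume_Ioc, div_eq_mul_inv, ENNReal.ofReal_mul (sub_nonneg.2 hab), mul_comm]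

/-- A rational majorant for the logarithm of a ratio: `log (a/b) ≤ (a² - b²)/(2ab)` for `0 < b ≤ a` (from
`log t ≤ (t - t⁻¹)/2`, `t ≥ 1`, i.e. `u ≤ sinh u`; cf. the tree's
`Literature.NumberTheory.LFunctions.MontgomeryVaughan.log_le_sub_inv_div_two`).  Applied per sub-panel after telescoping,
it turns each remaining inequality `R1 j` of stmt-Parity-19069 into a rational one (item evidence census §F10). -/
theorem log_div_le {a b : ℝ} (hb : 0 < b) (hab : b ≤ a) :
    Real.log (a / b) ≤ (a ^ 2 - b ^ 2) / (2 * a * b) := by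
  have ha : 0 < a := hb.trans_le hab
  have ht : (1:ℝ) ≤ a / b := (one_le_div hb).2 hab
  have ht0 : 0 < a / b := div_pos ha hb
  have h : Real.log (a / b) ≤ (a / b - (a / b)⁻¹) / 2 := by
    have h2 := Real.self_le_sinh_iff.mpr (Real.log_nonneg ht)
    rwa [Real.sinh_eq, Real.exp_neg, Real.exp_log ht0] at h2
  have e : (a / b - (a / b)⁻¹) / 2 = (a ^ 2 - b ^ 2) / (2 * a * b) := by
    field_simp
  rwa [e] at h

end RankActivity

end Summit.Parity.GeneralizedHardyLittlewood.Theses.PolymathEpsThreeCeiling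

end
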